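import Mathlib
import Summits.ResolutionOfSingularities.ResolutionOfSingularities.Theses.Valuative

/-!
# Sketch — first lemmas of the three crux ideas for `LuAlphaPTorsor` (stmt-0641), round 1, ideator 1

Cards (filed gen 2, 2026-08-15): `pfaff-line-log-final-forms` (criterion, content, budget lemmas),
`pbasis-flag-order-p-quotients` (multiplicative endpoint is toric), `formal-home-of-nu` (height one
forces the valuation upstairs). Nothing here is proved; the point is that each `First lemma:` of the
idea cards elaborates over Mathlib + the route file (rc 0, sorries only in the lemma bodies).
-/

namespace Summit.ResolutionOfSingularities.ResolutionOfSingularities.Cruxes.LuAlphaPTorsor.Ideator1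

open Polynomial IsLocalRing

/-! ## Card `pfaff-line-log-final-forms` (A) — the monogenic regularity criterion -/

/-- First lemma (card pfaff-line-log-final-forms). Over a regular local ring `S` of characteristic `p`, adjoining a
`p`-th root of `a` gives a regular local ring as soon as no translate `a - c^p` lies in `𝔪²`
(this single hypothesis covers both live cases: some `a - c^p ∈ 𝔪 ∖ 𝔪²`, or the residue of
`a` is not a `p`-th power, i.e. every `a - c^p` is a unit). -/
theorem adjoinRoot_pthRoot_isRegularLocalRing
    (p : ℕ) [Fact p.Prime] (S : Type) [CommRing S] [IsRegularLocalRing S] [CharP S p]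
    (a : S) (h : ∀ c : S, a - c ^ p ∉ (maximalIdeal S) ^ 2) :
    IsRegularLocalRing (AdjoinRoot (X ^ p - C a : S[X])) := by
  sorry

/-- Converse direction (card pfaff-line-log-final-forms): if the `p`-th-root extension is regular
then some translate of `a` avoids `𝔪²`. -/
theorem exists_translate_notMem_sq_of_isRegularLocalRing
    (p : ℕ) [Fact p.Prime] (S : Type) [CommRing S] [IsRegularLocalRing S] [CharP S p]
    (a : S) (h : IsRegularLocalRing (AdjoinRoot (X ^ p - C a : S[X]))) :
    ∃ c : S, a - c ^ p ∉ (maximalIdeal S) ^ 2 := by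
  sorry

/-! ## Card `pfaff-line-log-final-forms` (B) — content ideal of a Kähler form, its monotonicity (the ν-budget) -/

/-- The content ideal of a Kähler differential: the ideal of values of all linear functionals. -/
noncomputable def content (k A : Type) [CommRing k] [CommRing A] [Algebra k A]
    (ω : Ω[A⁄k]) : Ideal A :=
  Ideal.span (Set.range fun φ : Ω[A⁄k] →ₗ[A] A => φ ω)

/-- Budget lemma (card pfaff-line-log-final-forms, monotonicity = "the ν-adic norm of a fixed form only grows along
models"): along a `k`-algebra map `A → A'` the content of the image form is contained in the
extension of the content, provided `Ω[A⁄k]` is finite projective (e.g. `A` essentially smooth). -/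
theorem content_map_le
    (k A A' : Type) [CommRing k] [CommRing A] [CommRing A'] [Algebra k A] [Algebra k A']
    [Algebra A A'] [IsScalarTower k A A'] [Module.Finite A Ω[A⁄k]] [Module.Projective A Ω[A⁄k]]
    (ω : Ω[A⁄k]) :
    content k A' (KaehlerDifferential.map k k A A' ω) ≤ (content k A ω).map (algebraMap A A') := by
  sorry

/-- Blindness lemma (card pfaff-line-log-final-forms, the Frobenius blindness of `d`): derivations kill `p`-th powers, so
`d(a - c^p) = da` for every `c` — the exact form `da` is an invariant of the torsor class. -/
theorem derivation_map_pow_char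
    (p : ℕ) [Fact p.Prime] (k A M : Type) [CommRing k] [CommRing A] [Algebra k A] [CharP A p]
    [AddCommGroup M] [Module A M] [Module k M] [IsScalarTower k A M]
    (D : Derivation k A M) (c : A) : D (c ^ p) = 0 := by
  sorry

/-! ## Card `pbasis-flag-order-p-quotients` — invariants of a diagonal (μ_p-type) vector field are toric -/

/-- First lemma (card pbasis-flag-order-p-quotients, "multiplicative final form ⇒ toric quotient"): the Euler-type
derivation `θ_w = ∑ wᵢ xᵢ ∂ᵢ` kills a polynomial over a domain of characteristic `p` iff every
monomial `x^m` in its support has weight `∑ wᵢ mᵢ ≡ 0 (mod p)`; so the ring of invariants is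
the semigroup algebra of the kernel lattice (a toric ring). -/
theorem euler_derivation_eq_zero_iff
    (p : ℕ) [Fact p.Prime] (R : Type) [CommRing R] [IsDomain R] [CharP R p]
    (n : ℕ) (w : Fin n → ℕ) (f : MvPolynomial (Fin n) R) :
    (∑ i, (w i : MvPolynomial (Fin n) R) * (MvPolynomial.X i * MvPolynomial.pderiv i f)) = 0 ↔
      ∀ m ∈ f.support, ((∑ i, w i * m i : ℕ) : R) = 0 := by
  sorry

/-! ## Card `formal-home-of-nu` — height one ⇒ the valuation upstairs is read off downstairs -/

/-- First lemma (card `formal-home-of-nu`): for a height-one extension `K/K₀` (every `x^p`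
comes from `K₀`, e.g. `K = K₀(a^{1/p})`) a valuation ring `O` of `K` lying over `O₀` is forced:
`x ∈ O ↔ x^p ∈ O₀`. Hence `ν` on `K`, its completion, implicit ideals and formal home are all
determined inside `(K₀, ν₀)`. -/
theorem mem_valuationSubring_iff_pow_mem_of_heightOne
    (p : ℕ) [Fact p.Prime] (K₀ K : Type) [Field K₀] [Field K] [Algebra K₀ K]
    (root : K → K₀) (hroot : ∀ x : K, algebraMap K₀ K (root x) = x ^ p)
    (O₀ : ValuationSubring K₀) (O : ValuationSubring K)
    (hO : O.comap (algebraMap K₀ K) = O₀) (x : K) :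
    x ∈ O ↔ root x ∈ O₀ := by
  sorry

/-! ## The crux, by name (nothing composed at ideate stage) -/

example : Prop := Summit.ResolutionOfSingularities.ResolutionOfSingularities.Theses.Valuative.LuAlphaPTorsor

end Summit.ResolutionOfSingularities.ResolutionOfSingularities.Cruxes.LuAlphaPTorsor.Ideator1
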